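import Mathlib
import Summits.Ventures.HodgeRepro2.Tier7.Line3.DetSection
import Summits.Ventures.HodgeRepro2.Tier7.Line3.LocalHilbert90

/-!
# Tier7/Line3/NormOneBridge — `u σ(u) = N_{L/K}(u)` for a quadratic Galois extension: LocalHilbert90 and DetSection compose

Filer: t7-L1-p3 (gen 4, prover-pub-hodge-repro2-t7-L1-p3-g4-0), TARGET line STATUS l. 15386 (seventh target). Lane: SUPPORT for Line 3's
version-(ii) chain (L3-ARGUMENT.md §2f, the `a_γ₀ ≠ 0` row: Lemma WA′ — the two kernel rows LocalHilbert90 p678170 (the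
Hilbert-90 surjection onto `(Units.map (Algebra.norm K)).ker`) and DetSection p680562 (the det section into
`isomGroup σ d` over the norm-one group `normOne σ = {u | u σ(u) = 1}`) name the norm-one group of `E_v` in two ways;
this file identifies them, so that the two rows plug into ONE instance of `DensityTransfer.dense_of_approximations`);
NOT a line, NOT a device.

WHAT IT SUPPLIES. For a quadratic Galois extension `L/K` (`Fintype.card Gal(L/K) = 2`) with its non-trivial automorphism `g`:

* (B1) `algebraMap_norm_eq_mul_aut` — `N_{L/K}(x) = x · g(x)` (Mathlib's `Algebra.norm_eq_prod_automorphisms` over the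
  two-element Galois group), i.e. `nrm g x = algebraMap K L (Algebra.norm K x)` (`nrm_eq_algebraMap_norm`).
* (B2) `mem_normOne_iff_norm_eq_one` / `normOne_eq_ker_norm` — DetSection's `normOne (g : L →+* L)` IS LocalHilbert90's
  `(Units.map (Algebra.norm K)).ker`, as subgroups of `Lˣ`.
* (B3) `exists_continuous_surjective_div_aut_normOne` — the local Hilbert-90 map `y ↦ y / g y` is a continuous surjection
  `Lˣ → normOne g` (the `(q v, hq v, hqs v)` input of `dense_of_approximations` with `N v = normOne g`, the same `N v`
  that DetSection's section `s v` and determinant `det v` use) — `L/K` finite cyclic Galois over a complete nontrivially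
  normed `K`, `L` a finite-dimensional T2 topological `K`-algebra.
* (B4) `exists_local_data` — THE LOCAL PACKAGE at a non-split place: for the adapted form `herm g d` on `L²` (`d i ≠ 0`),
  the determinant `detHom g d`, corestricted to `normOne g`, has a continuous section (DetSection) and the norm-one group is
  the target of a continuous surjection from `Lˣ` (Hilbert 90) — every displayed LOCAL input of `dense_of_approximations`
  at that place, in one statement.

NOT in this file: the dictionary (`E′_v = L`, `F_v = K`, `σ_v = g`, `U(W_A)(F_v) = isomGroup g d`), the split places
(`L = K × K`: LocalHilbert90 (H5) and DetSection over the ring `K × K` — in words), the global matching (H90) and (SA);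
nothing about `X`; nothing about the step (P) is claimed.

§8(d) (uses an L-value-free non-vanishing device): NO — Galois bookkeeping.
-/

namespace Summit.Ventures.HodgeRepro2.Tier7.Line3.NormOneBridge

open Function Summit.Ventures.HodgeRepro2.T7SupportTwoTorusInvariant
open Summit.Ventures.HodgeRepro2.Tier7.Line3.DetSection
open Summit.Ventures.HodgeRepro2.Tier7.Line3.LocalHilbert90

section Quadratic

variable {K L : Type} [Field K] [Field L] [Algebra K L] [FiniteDimensional K L] [IsGalois K L]

/-- (B1) For a quadratic Galois extension with non-trivial automorphism `g`, `N_{L/K}(x) = x · g(x)`. -/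
theorem algebraMap_norm_eq_mul_aut (hcard : Fintype.card (L ≃ₐ[K] L) = 2) (g : L ≃ₐ[K] L)
    (hg : g ≠ 1) (x : L) : algebraMap K L (Algebra.norm K x) = x * g x := by
  classical
  rw [Algebra.norm_eq_prod_automorphisms]
  have huniv : (Finset.univ : Finset (L ≃ₐ[K] L)) = {1, g} := by
    symm
    apply Finset.eq_univ_of_card
    rw [Finset.card_pair hg.symm, hcard]
  rw [huniv, Finset.prod_pair hg.symm]
  simp

/-- (B1) p1's `nrm` of the non-trivial automorphism is the field norm. -/
theorem nrm_eq_algebraMap_norm (hcard : Fintype.card (L ≃ₐ[K] L) = 2) (g : L ≃ₐ[K] L) (hg : g ≠ 1)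
    (x : L) : nrm (g : L →+* L) x = algebraMap K L (Algebra.norm K x) := by
  rw [nrm, algebraMap_norm_eq_mul_aut hcard g hg]
  rfl

/-- (B2) A unit has `u · g(u) = 1` iff its field norm is `1`. -/
theorem mem_normOne_iff_norm_eq_one (hcard : Fintype.card (L ≃ₐ[K] L) = 2) (g : L ≃ₐ[K] L)
    (hg : g ≠ 1) (u : Lˣ) : u ∈ normOne (g : L →+* L) ↔ Algebra.norm K (u : L) = 1 := by
  rw [mem_normOne_iff, nrm_eq_algebraMap_norm hcard g hg]
  constructor
  · intro h
    exact (algebraMap K L).injective (by rw [h, map_one])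
  · intro h
    rw [h, map_one]

/-- (B2) DetSection's norm-one group IS LocalHilbert90's kernel of the norm, as subgroups of `Lˣ`. -/
theorem normOne_eq_ker_norm (hcard : Fintype.card (L ≃ₐ[K] L) = 2) (g : L ≃ₐ[K] L) (hg : g ≠ 1) :
    normOne (g : L →+* L) = (Units.map (Algebra.norm K : L →* K)).ker := by
  ext u
  rw [mem_normOne_iff_norm_eq_one hcard g hg, MonoidHom.mem_ker]
  constructor
  · intro h
    ext
    simpa using h
  · intro h
    exact norm_eq_one_of_mem_ker h

end Quadratic

section Topological

variable {K L : Type} [NontriviallyNormedField K] [CompleteSpace K] [Field L] [Algebra K L]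
  [TopologicalSpace L] [IsTopologicalRing L] [ContinuousSMul K L] [T2Space L]
  [FiniteDimensional K L] [IsGalois K L] [IsCyclic (L ≃ₐ[K] L)]

/-- (B3) The local Hilbert-90 map `y ↦ y / g y` as a continuous surjection onto DetSection's `normOne g`
(`g` a generator of the Galois group, `g ≠ 1`, the group of order 2). -/
theorem exists_continuous_surjective_div_aut_normOne (hcard : Fintype.card (L ≃ₐ[K] L) = 2)
    {g : L ≃ₐ[K] L} (hg : g ≠ 1) (hgen : ∀ x, x ∈ Subgroup.zpowers g) :
    ∃ q : Lˣ → normOne (g : L →+* L), Continuous q ∧ Surjective q ∧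
      ∀ y, (q y : Lˣ) = y / Units.map (g : L →* L) y := by
  refine ⟨fun y => ⟨y / Units.map (g : L →* L) y, ?_⟩, ?_, ?_, fun _ => rfl⟩
  · rw [normOne_eq_ker_norm hcard g hg]
    exact div_aut_mem_ker g y
  · exact (continuous_div_aut g).subtype_mk _
  · rintro ⟨u, hu⟩
    rw [normOne_eq_ker_norm hcard g hg] at hu
    obtain ⟨y, hy⟩ := surjective_div_aut hgen ⟨u, hu⟩
    refine ⟨y, ?_⟩
    ext1
    simpa using congrArg Subtype.val hy

/-- (B4) THE LOCAL PACKAGE at a non-split place: with `N = normOne g` as the norm-one group, the determinant of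
the unitary group `isomGroup g d` lands in `N` (`det_mem_normOne`), has a continuous section (DetSection), and
`N` is the target of a continuous surjection from `Lˣ` (Hilbert 90) — every displayed local input of
`DensityTransfer.dense_of_approximations` at the place, at once. -/
theorem exists_local_data (hcard : Fintype.card (L ≃ₐ[K] L) = 2) {g : L ≃ₐ[K] L} (hg : g ≠ 1)
    (hgen : ∀ x, x ∈ Subgroup.zpowers g) (d : Fin 2 → L) (hd : ∀ i, d i ≠ 0) :
    (∀ γ : isomGroup (g : L →+* L) d, detHom (g : L →+* L) d γ ∈ normOne (g : L →+* L)) ∧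
    (∃ s : normOne (g : L →+* L) → isomGroup (g : L →+* L) d,
      Continuous s ∧ ∀ u, detHom (g : L →+* L) d (s u) = (u : Lˣ)) ∧
    (∃ q : Lˣ → normOne (g : L →+* L), Continuous q ∧ Surjective q) := by
  refine ⟨fun γ => det_mem_normOne (g : L →+* L) d hd γ, exists_continuous_section_det (g : L →+* L) d, ?_⟩
  obtain ⟨q, hq, hqs, -⟩ := exists_continuous_surjective_div_aut_normOne hcard hg hgen
  exact ⟨q, hq, hqs⟩

end Topological

end Summit.Ventures.HodgeRepro2.Tier7.Line3.NormOneBridge
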